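import Summits.QuantumFields.BalabanUV.Beta.FP.TorusOneShotColumnGaugeProjSym
import Summits.QuantumFields.BalabanUV.Beta.FP.RelInvPeriodised

/-!
# `BalabanUV.Beta.FP.TorusWJunctionOfNLeg` — road «FP» for binder row D1, ROUTE T (β1), SPEC-50 §B (J-W″) FROM THE WRAPPER's OWN N LEG:
# **`hv (r•e_a) b = r·(perF T A) ((b.1, inl b.2), fN a) − Σ_s tgrad T (b.1, inl b.2) s · lam s`, `lam := −λ̂((P·W₀)⁻¹·(P·hv (r•e_a)))`** — the (J-W″) hypothesis of
# `TorusNBindingOfJunctionsGauge.hHN1_named_of_junctions_gauge_pin` is the END wrapper's displayed N leg `hLN ∕ hEAN` read through g39's gauge projection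

WHY.  Under RULING R-FP-79 the N-binding `hHN₁` rests on (J-W″) «the top-storey direction is `r·colN − tgrad·lv`», the scalar pin and (J-Λ)
(`TorusNBindingOfJunctionsGauge`, (E4d)).  (J-W″) itself is bookkeeping over rows the wrapper ALREADY displays: the one-shot N system's right inverse `XN` (`hXN`), its
LEG `hLN` (the `(fields ⊕ coarse slots)²` blocks of `XN` = the periodised N chart `perF T (AN R (n+1))` masked by the axial projector `axEc ρN LNc`) and the torus rule `hEAN`
(`Ê·Â = Â`), plus g39's `TorusOneShotColumnGaugeProjSym.XN_toBlocks₁₂_mulVec_eq_gaugeProj_sym` (`XN₁₂·(v,0) = hv v − W₀·((PW₀)⁻¹·(P·hv v))`, no side letter at the pins) and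
`TorusOneShotColumnGaugeProjG.towerGen_mulVec_apply_eq_tgrad` (every tower mode is exact).  THIS FILE does that bookkeeping once: at the source `v := r • Pi.single a 1`
the `12` block of `hLN` gives `Σ_{a′} XN (inl b) (inr (inl a′))·v a′ = r·axEc(b)·Â(b, fN a) = r·Â(b, fN a)` (`perF_axEc`: `Ê` is diagonal, so `hEAN` removes the mask
entrywise), and the gauge term is `tgrad·λ̂θ`.  So the (C1) instantiation's `hJW` for `hHN₁ n μ y B` is THIS theorem at `A := AN (Roots.ctr Lc) (n+1)`, `a := ` the coarse slot
with `fN n B a = (wrapPt T (Lc^(n+2)•y), inr μ)`, `r := cE (n+2) ∕ (−2·c n)`, and `lv n B (dv n B (μ,y)) := lam` below.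

WHAT ([folklore] bookkeeping BY NAME; no `def`, no `def … : Prop`, nothing cited, 0 sorry): `leg12_of_hLN` (the `12` block of the displayed leg, entrywise),
`mask_apply_eq_of_hEA` (`Ê·Â = Â` entrywise through `RelInvPeriodised.perF_axEc`), **`hv_single_apply_eq_of_NLeg_sym`** (the statement above, at #21-SymB's pins +
the wrapper's `h𝔔₀ hI hS hhv hXN hLN hEAN`).  WHAT THIS IS NOT: not the slot bookkeeping `fN a = (wrapPt T (N•y), inr μ)` (`hcN`), not (J-Λ), not `hQN₁`; no row of the
END wrapper discharged; nothing of Bałaban's asserted, valued or discharged; 0 estimates; 0∕4 row-D1 binders (hW, hR, D1Tel, D1Rep); ROOT M‴ p325680 untouched;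
NOT (C1), NOT (L2′), NOT (T-ID), NOT SDF, NOT D1, NOT BetaPertH, NOT continuum, NOT Clay.

HONEST DEPENDENCY (page 1, mandatory): continuum YM on T⁴ ⇐ BetaPertH ∧ nine spine estimates (0/9 proved); BetaPertH ⇐ (D1) ∧ (D4) ∧ CAP+tail;
G-an2-4 gates asym, D1 and NE2/3/4.  HONEST FRAMING (cell contract, verbatim): «discharging `BetaPertH` makes Bałaban's UV stability UNCONDITIONAL —
a real constructive-QFT result; it is NOT the continuum limit and NOT the Clay problem.»  ABSOLUTE RULE (cell charter, verbatim): «No internally-minted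
statement may enter as a cited fact. Every hypothesis is either kernel-proved in this package or a verbatim quotation of a PUBLISHED theorem with page
reference. The manuscript(s) under audit are NOT citable for their own disputed steps — they are the thing under adjudication; programme-internal
(2001/route/tribunal) claims are never citable.»  Road «FP» OWNER, b2b-balaban-beta-d1-p3 gen 39, 2026-08-27.  No existing file touched.
-/

noncomputable section

namespace Summit.QuantumFields.BalabanUV.Beta.FP.TorusWJunctionOfNLeg

open Matrix Finset
open Literature.Probability.LatticeModels (Torus.proj)
open Literature.MathematicalPhysics.QuantumFieldTheory.Balaban1983to89
open Literature.MathematicalPhysics.QuantumFieldTheory.Balaban1983to89.Beta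
open Literature.MathematicalPhysics.QuantumFieldTheory.Balaban1983to89.Beta.Composition (kkt)
open Literature.MathematicalPhysics.QuantumFieldTheory.Balaban1983to89.Beta.CompositionSingular (effForm minOp)
open B5Prop11Plancherel (fine)
open B6Lemma24Torus (pbox)
open AffineAveraging (Site box toSite)
open AveragingContoursRooted (ctrOff)
open OneStepResolventKernel (Fib)
open ExpKernelCalculus (MKer)
open Summit.QuantumFields.BalabanUV.Beta.AxialDressingRooted (axEc)
open Summit.QuantumFields.BalabanUV.Beta.SymShiftedSpread (bhKStepSh)
open Summit.QuantumFields.BalabanUV.Beta.DshAn1 (Dsh)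
open Summit.QuantumFields.BalabanUV.Beta.FP.KernelPeriodisationFib (Idx perF)
open Summit.QuantumFields.BalabanUV.Beta.FP.TorusCombRows (Res)
open Summit.QuantumFields.BalabanUV.Beta.FP.TorusGaugeCovariance (tgrad)
open Summit.QuantumFields.BalabanUV.Beta.FP.TorusCompositeObjects (towerTorus NParam combF bigP towerGen bigRoot bigRatio towerEquiv)
open Summit.QuantumFields.BalabanUV.Beta.FP.TorusCompositeObjectsG (compRowsSym)
open Summit.QuantumFields.BalabanUV.Beta.FP.TorusCompositeUnimodular (towerEvalC)
open Summit.QuantumFields.BalabanUV.Beta.FP.RelInvPeriodised (perF_axEc)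
open Summit.QuantumFields.BalabanUV.Beta.GAN24.FineReadoutCauchyFrame (toSite_mem_range)
open Summit.QuantumFields.BalabanUV.Beta.FP.TorusOneShotColumnGaugeProjG (towerGen_mulVec_apply_eq_tgrad)
open Summit.QuantumFields.BalabanUV.Beta.FP.TorusOneShotColumnGaugeProjSym (XN_toBlocks₁₂_mulVec_eq_gaugeProj_sym)

variable {d : ℕ}

/-! ## §1 The `12` block of the displayed leg, and the mask removed by `Ê·Â = Â` -/

section Leg

variable (M : Fin (d + 1) → ℕ) [∀ μ, NeZero (M μ)] {κ ρ : Type*}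

omit [∀ μ, NeZero (M μ)] in
/-- [folklore] **THE `12` BLOCK OF THE WRAPPER's DISPLAYED LEG `hLN`, ENTRYWISE**: from the block equation on `XN.submatrix (Sum.map id inl)²` read the
`(inl b, inr (inl a))` entry: `XN (inl b) (inr (inl a)) = axEc(b)·(perF M A) ((b.1, inl b.2), f a)`. -/
theorem leg12_of_hLN (ρN : Site (d + 1)) (LNc : ℕ) (A : MKer (d + 1) (Fib d)) (f : κ → Idx M (Fib d))
    {XN : Matrix ((↥(pbox M) × Fin (d + 1)) ⊕ (κ ⊕ ρ)) ((↥(pbox M) × Fin (d + 1)) ⊕ (κ ⊕ ρ)) ℝ}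
    (hLN : XN.submatrix (Sum.map id Sum.inl) (Sum.map id Sum.inl) = fromBlocks
      (Matrix.of fun (b b' : (↥(pbox M) × Fin (d + 1))) =>
        axEc ρN LNc (b.1 : Site (d + 1)) (b.1 : Site (d + 1)) (Sum.inl b.2) (Sum.inl b.2)
          * (axEc ρN LNc (b'.1 : Site (d + 1)) (b'.1 : Site (d + 1)) (Sum.inl b'.2) (Sum.inl b'.2) * perF M A (b.1, Sum.inl b.2) (b'.1, Sum.inl b'.2)))
      (Matrix.of fun (b : (↥(pbox M) × Fin (d + 1))) (a : κ) =>
        axEc ρN LNc (b.1 : Site (d + 1)) (b.1 : Site (d + 1)) (Sum.inl b.2) (Sum.inl b.2) * perF M A (b.1, Sum.inl b.2) (f a))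
      (-Matrix.of fun (a : κ) (b : (↥(pbox M) × Fin (d + 1))) =>
        axEc ρN LNc (b.1 : Site (d + 1)) (b.1 : Site (d + 1)) (Sum.inl b.2) (Sum.inl b.2) * perF M A (f a) (b.1, Sum.inl b.2))
      (-((perF M A).submatrix f f)))
    (b : ↥(pbox M) × Fin (d + 1)) (a : κ) :
    XN (Sum.inl b) (Sum.inr (Sum.inl a)) = axEc ρN LNc (b.1 : Site (d + 1)) (b.1 : Site (d + 1)) (Sum.inl b.2) (Sum.inl b.2) * perF M A (b.1, Sum.inl b.2) (f a) := by
  have e := congrFun (congrFun hLN (Sum.inl b)) (Sum.inr a)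
  simpa [Matrix.submatrix_apply, Matrix.fromBlocks_apply₁₂] using e

/-- [folklore] **`Ê·Â = Â` ENTRYWISE REMOVES THE MASK**: `perF M (axEc ρ L)` is the diagonal of `axEc`'s own diagonal (`RelInvPeriodised.perF_axEc`), so
`Ê·Â = Â` reads `axEc(p)·Â(p,q) = Â(p,q)`. -/
theorem mask_apply_eq_of_hEA (ρN : Site (d + 1)) (LNc : ℕ) (A : MKer (d + 1) (Fib d))
    (hEA : perF M (axEc ρN LNc) * perF M A = perF M A) (p q : Idx M (Fib d)) :
    axEc ρN LNc (p.1 : Site (d + 1)) (p.1 : Site (d + 1)) p.2 p.2 * perF M A p q = perF M A p q := by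
  have e := congrFun (congrFun hEA p) q
  rwa [perF_axEc, Matrix.diagonal_mul] at e

end Leg

/-! ## §2 (J-W″) at the END wrapper's pins -/

section WJunction

variable (M' : Fin (d + 1) → ℕ) [∀ μ, NeZero (M' μ)] (Lc : ℕ) [NeZero Lc] (lev : ℕ → ℕ) (n : ℕ)

set_option synthInstance.maxSize 1024 in
/-- [folklore] **`hv_single_apply_eq_of_NLeg_sym` — (J-W″) FROM THE WRAPPER's OWN ROWS.**  At #21-SymB's pins (as in `XN_toBlocks₁₂_mulVec_eq_gaugeProj_sym`) plus the
wrapper's N leg `hLN` (with a generic chart kernel `A` for `AN (Roots.ctr Lc) (n+1)`, slot map `fN`, mask `axEc ρN LNc`) and torus rule `hEAN`: for every scale `r`, coarse slot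
`a` and finest bond `b`,
`hv (r • Pi.single a 1) b = r·(perF T A) ((b.1, inl b.2), fN a) − Σ_s tgrad T (b.1, inl b.2) s · lam s`,
`lam s := −Σ_{x : Res (bigRoot) (bigRatio) T} [x.1 = s]·(towerEvalC·θ)(towerEquiv x)`, `θ := (P·W₀)⁻¹·(P·hv (r • Pi.single a 1))` — the shape of
`TorusNBindingOfJunctionsGauge`'s (J-W″) binder `hJW` with `l := lam` (= the instantiation's `lv n B (dv n B (μ,y))`). -/
theorem hv_single_apply_eq_of_NLeg_sym (hrs : ∀ _k : ℕ, ctrOff (d + 1) Lc ∈ box (d + 1) Lc)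
    (hlev : ∀ i, i ≤ n → lev i = lev (i + 1) + 1) (hM' : ∀ i, Lc ∣ M' i)
    {κ : Type*} [Fintype κ] [DecidableEq κ] (pμ' : κ → ↥(pbox M')) (mμ' : κ → Fin (d + 1))
    (hfμ' : Function.Injective (fun a : κ => ((pμ' a, Sum.inr (mμ' a)) : Idx M' (Fib d))))
    (hcoarse' : ∀ (s : ↥(pbox M')) (m : Fin (d + 1)),
      ((s, Sum.inr m) : Idx M' (Fib d)) ∈ Set.range (fun a : κ => ((pμ' a, Sum.inr (mμ' a)) : Idx M' (Fib d))) ↔ Torus.proj Lc (s : Site (d + 1)) = 0)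
    {H₀ : Matrix (↥(pbox (towerTorus Lc M' (n + 1))) × Fin (d + 1)) (↥(pbox (towerTorus Lc M' (n + 1))) × Fin (d + 1)) ℝ}
    {Q₁₀ : Matrix (↥(pbox M') × Fin (d + 1)) (↥(pbox (towerTorus Lc M' (n + 1))) × Fin (d + 1)) ℝ}
    {τ₁ : Matrix (NParam Lc (fine Lc M') (fun k => (fun _ : ℕ => ctrOff (d + 1) Lc) (k + 1)) n) (↥(pbox (towerTorus Lc M' (n + 1))) × Fin (d + 1)) ℝ}
    (hH₀ : H₀ = (perF (towerTorus Lc M' (n + 1)) (bhKStepSh d Lc (Dsh Lc) (lev (n + 1)))).submatrix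
        (fun b : ↥(pbox (towerTorus Lc M' (n + 1))) × Fin (d + 1) => ((b.1, Sum.inl b.2) : Idx (towerTorus Lc M' (n + 1)) (Fib d)))
        (fun b : ↥(pbox (towerTorus Lc M' (n + 1))) × Fin (d + 1) => ((b.1, Sum.inl b.2) : Idx (towerTorus Lc M' (n + 1)) (Fib d))))
    (hQ₁₀ : Q₁₀ = compRowsSym Lc M' lev (fun _ : ℕ => ctrOff (d + 1) Lc) (n + 1))
    (hτ₁ : τ₁ = bigP Lc (fine Lc M') (fun k => (fun _ : ℕ => ctrOff (d + 1) Lc) (k + 1)) (fun k => toSite_mem_range (hrs (k + 1))) n)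
    {τ₂ : Matrix (Res (toSite (ctrOff (d + 1) Lc)) Lc M') (↥(pbox M') × Fin (d + 1)) ℝ} (hτ₂ : τ₂ = combF Lc M' ((fun _ : ℕ => ctrOff (d + 1) Lc) 0))
    {Q₂₀ : Matrix κ (↥(pbox M') × Fin (d + 1)) ℝ}
    (hQ₂₀ : Q₂₀ = (perF M' (bhKStepSh d Lc (Dsh Lc) (lev 0))).submatrix (fun a : κ => ((pμ' a, Sum.inr (mμ' a)) : Idx M' (Fib d)))
        (fun b : ↥(pbox M') × Fin (d + 1) => ((b.1, Sum.inl b.2) : Idx M' (Fib d))))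
    {W₀ : Matrix (↥(pbox (towerTorus Lc M' (n + 1))) × Fin (d + 1)) (NParam Lc M' (fun _ : ℕ => ctrOff (d + 1) Lc) (n + 1)) ℝ}
    (hW₀ : W₀ = towerGen Lc M' (fun _ : ℕ => ctrOff (d + 1) Lc) (n + 1))
    {P : Matrix (NParam Lc M' (fun _ : ℕ => ctrOff (d + 1) Lc) (n + 1)) (↥(pbox (towerTorus Lc M' (n + 1))) × Fin (d + 1)) ℝ}
    (hP : P = bigP Lc M' (fun _ : ℕ => ctrOff (d + 1) Lc) (fun k => toSite_mem_range (hrs k)) (n + 1))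
    {𝔔₀ : Matrix κ (↥(pbox (towerTorus Lc M' (n + 1))) × Fin (d + 1)) ℝ} (h𝔔₀ : Q₂₀ * Q₁₀ = 𝔔₀)
    {I : Matrix (↥(pbox (towerTorus Lc M' (n + 1))) × Fin (d + 1))
      ((↥(pbox M') × Fin (d + 1)) ⊕ NParam Lc (fine Lc M') (fun k => (fun _ : ℕ => ctrOff (d + 1) Lc) (k + 1)) n) ℝ}
    {S : Matrix ((↥(pbox M') × Fin (d + 1)) ⊕ NParam Lc (fine Lc M') (fun k => (fun _ : ℕ => ctrOff (d + 1) Lc) (k + 1)) n)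
      ((↥(pbox M') × Fin (d + 1)) ⊕ NParam Lc (fine Lc M') (fun k => (fun _ : ℕ => ctrOff (d + 1) Lc) (k + 1)) n) ℝ}
    (hI : minOp H₀ (fromRows Q₁₀ τ₁) = I) (hS : effForm H₀ (fromRows Q₁₀ τ₁) = S)
    {hv : (κ → ℝ) → ((↥(pbox (towerTorus Lc M' (n + 1))) × Fin (d + 1)) → ℝ)}
    (hhv : ∀ v, hv v = I *ᵥ Sum.elim (minOp S.toBlocks₁₁ (fromRows Q₂₀ τ₂) *ᵥ Sum.elim v 0) 0)
    {XN : Matrix ((↥(pbox (towerTorus Lc M' (n + 1))) × Fin (d + 1)) ⊕ (κ ⊕ NParam Lc M' (fun _ : ℕ => ctrOff (d + 1) Lc) (n + 1)))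
      ((↥(pbox (towerTorus Lc M' (n + 1))) × Fin (d + 1)) ⊕ (κ ⊕ NParam Lc M' (fun _ : ℕ => ctrOff (d + 1) Lc) (n + 1))) ℝ}
    (hXN : kkt H₀ (fromRows 𝔔₀ P) * XN = 1)
    -- the N leg and the torus rule, at a generic chart kernel `A` (the wrapper: `A := AN (Roots.ctr Lc) (n+1)`)
    (ρN : Site (d + 1)) (LNc : ℕ) (A : MKer (d + 1) (Fib d)) (fN : κ → Idx (towerTorus Lc M' (n + 1)) (Fib d))
    (hEAN : perF (towerTorus Lc M' (n + 1)) (axEc ρN LNc) * perF (towerTorus Lc M' (n + 1)) A = perF (towerTorus Lc M' (n + 1)) A)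
    (hLN : XN.submatrix (Sum.map id Sum.inl) (Sum.map id Sum.inl) = fromBlocks
      (Matrix.of fun (b b' : (↥(pbox (towerTorus Lc M' (n + 1))) × Fin (d + 1))) =>
        axEc ρN LNc (b.1 : Site (d + 1)) (b.1 : Site (d + 1)) (Sum.inl b.2) (Sum.inl b.2)
          * (axEc ρN LNc (b'.1 : Site (d + 1)) (b'.1 : Site (d + 1)) (Sum.inl b'.2) (Sum.inl b'.2)
            * perF (towerTorus Lc M' (n + 1)) A (b.1, Sum.inl b.2) (b'.1, Sum.inl b'.2)))
      (Matrix.of fun (b : (↥(pbox (towerTorus Lc M' (n + 1))) × Fin (d + 1))) (a : κ) =>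
        axEc ρN LNc (b.1 : Site (d + 1)) (b.1 : Site (d + 1)) (Sum.inl b.2) (Sum.inl b.2) * perF (towerTorus Lc M' (n + 1)) A (b.1, Sum.inl b.2) (fN a))
      (-Matrix.of fun (a : κ) (b : (↥(pbox (towerTorus Lc M' (n + 1))) × Fin (d + 1))) =>
        axEc ρN LNc (b.1 : Site (d + 1)) (b.1 : Site (d + 1)) (Sum.inl b.2) (Sum.inl b.2) * perF (towerTorus Lc M' (n + 1)) A (fN a) (b.1, Sum.inl b.2))
      (-((perF (towerTorus Lc M' (n + 1)) A).submatrix fN fN)))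
    (r : ℝ) (a : κ) (b : ↥(pbox (towerTorus Lc M' (n + 1))) × Fin (d + 1)) :
    hv (r • Pi.single a 1) b
      = r * perF (towerTorus Lc M' (n + 1)) A (b.1, Sum.inl b.2) (fN a)
        - ∑ s : ↥(pbox (towerTorus Lc M' (n + 1))), tgrad (towerTorus Lc M' (n + 1)) (b.1, Sum.inl b.2) s *
          -(∑ x : Res (bigRoot Lc (fun _ : ℕ => ctrOff (d + 1) Lc) (n + 1)) (bigRatio Lc (n + 1)) (towerTorus Lc M' (n + 1)),
            (if (x.1 : ↥(pbox (towerTorus Lc M' (n + 1)))) = s then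
              (towerEvalC Lc M' (fun _ : ℕ => ctrOff (d + 1) Lc) (fun k => toSite_mem_range (hrs k)) (n + 1)
                *ᵥ ((P * W₀)⁻¹ *ᵥ (P *ᵥ hv (r • Pi.single a 1))))
                (towerEquiv Lc M' (fun _ : ℕ => ctrOff (d + 1) Lc) (fun k => toSite_mem_range (hrs k)) (n + 1) x) else 0)) := by
  have hproj := congrFun (XN_toBlocks₁₂_mulVec_eq_gaugeProj_sym M' Lc lev n hrs hlev hM' pμ' mμ' hfμ' hcoarse' hH₀ hQ₁₀ hτ₁ hτ₂ hQ₂₀ hW₀ hP h𝔔₀ hI hS hhv hXN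
    (r • Pi.single a 1)) b
  -- the left side, entry `b`: only the `(inl b, inr (inl a))` entry of `XN` survives, read by the leg and unmasked by the torus rule
  have hL : (XN.toBlocks₁₂ *ᵥ Sum.elim (r • Pi.single a (1 : ℝ)) 0) b = r * perF (towerTorus Lc M' (n + 1)) A (b.1, Sum.inl b.2) (fN a) := by
    simp only [mulVec, dotProduct, Fintype.sum_sum_type, Sum.elim_inl, Sum.elim_inr, Pi.zero_apply, mul_zero, Finset.sum_const_zero, add_zero,
      Matrix.toBlocks₁₂, Matrix.of_apply, Pi.smul_apply, smul_eq_mul]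
    rw [Finset.sum_eq_single a (fun a' _ ha' => by rw [Pi.single_eq_of_ne ha', mul_zero, mul_zero]) (fun h => (h (Finset.mem_univ a)).elim),
      Pi.single_eq_same, mul_one, leg12_of_hLN (towerTorus Lc M' (n + 1)) ρN LNc A fN hLN b a,
      mask_apply_eq_of_hEA (towerTorus Lc M' (n + 1)) ρN LNc A hEAN (b.1, Sum.inl b.2) (fN a), mul_comm]
  -- the gauge term, entry `b`: every tower mode is exact
  have hR : (W₀ *ᵥ ((P * W₀)⁻¹ *ᵥ (P *ᵥ hv (r • Pi.single a 1)))) b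
      = ∑ s : ↥(pbox (towerTorus Lc M' (n + 1))), tgrad (towerTorus Lc M' (n + 1)) (b.1, Sum.inl b.2) s *
          ∑ x : Res (bigRoot Lc (fun _ : ℕ => ctrOff (d + 1) Lc) (n + 1)) (bigRatio Lc (n + 1)) (towerTorus Lc M' (n + 1)),
            (if (x.1 : ↥(pbox (towerTorus Lc M' (n + 1)))) = s then
              (towerEvalC Lc M' (fun _ : ℕ => ctrOff (d + 1) Lc) (fun k => toSite_mem_range (hrs k)) (n + 1)
                *ᵥ ((P * W₀)⁻¹ *ᵥ (P *ᵥ hv (r • Pi.single a 1))))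
                (towerEquiv Lc M' (fun _ : ℕ => ctrOff (d + 1) Lc) (fun k => toSite_mem_range (hrs k)) (n + 1) x) else 0) := by
    rw [hW₀]
    exact towerGen_mulVec_apply_eq_tgrad Lc M' (fun _ : ℕ => ctrOff (d + 1) Lc) (fun k => toSite_mem_range (hrs k)) (n + 1) _ b
  rw [Pi.sub_apply, hL] at hproj
  rw [eq_sub_iff_add_eq] at hproj
  rw [← hproj, hR]
  simp only [mul_neg, Finset.sum_neg_distrib, sub_neg_eq_add]

end WJunction

end Summit.QuantumFields.BalabanUV.Beta.FP.TorusWJunctionOfNLeg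

end
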